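import Summits.NavierStokesRegularity.NavierStokesRegularity.Theorems.ExtremiserTransienceNearExtremalTransienceScaling
import Mathlib.Algebra.Order.Floor.Defs
import HarnessLib

/-!
# Route `ExtremiserTransience`, crux `NearExtremalTransience` (stmt-NavierStokesRegularity-21883):
# ON THE DSS STRATUM THE LOG-TIME MEAN OF THE EFFICIENCY IS ITS PERIOD AVERAGE

`--supports stmt-NavierStokesRegularity-21883` (route-independent). Author: prover seat `ns-et-p1` (g2).
The crux's BC5 rung restricts it to flows that are discretely self-similar about the singular time `T`
(`IsDiscretelySelfSimilar c (fun s x => u (T + s) x)`, `1 < c`). Along such a flow every minimal flow-wise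
depletion coefficient `k₀` (the stretching efficiency `R(t)`) is log-periodic with period `ℓ = log(c²)`
(`DepletionLadder.minimalCoeff_logPeriodic_of_dss`, file `…Scaling`). Consequently:

* `blocksToLog_general` — calculus: per-block bounds `∫_{s n}^{s (n+1)} g ≤ A` on the log-blocks
  `s n = T − (T−t₁)e^{−nℓ}` of ANY log-length `ℓ > 0` give `∫_{t₁}^t g ≤ (A/ℓ)·log((T−t₁)/(T−t)) + A`
  (the case `ℓ = 1` is the landed `Birth.stub_blocksToLog`, p577560).
* `dss_integral_shift`, `dss_block_integral_eq` — along a DSS flow all `ℓ = log(c²)`-blocks of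
  `k₀²/(T−τ)` carry THE SAME mass `I₀` (substitution `τ ↦ T − (T−τ)/c²` and log-periodicity).
* `logMean_le_periodAverage_of_dss` — **hence** for every onset `t₁ ∈ [0,T)` and all `t ∈ [t₁,T)`:
  `∫_{t₁}^t k₀²/(T−τ) ≤ (I₀/log(c²))·log((T−t₁)/(T−t)) + I₀`, `I₀ = ∫_{t₁}^{T−(T−t₁)/c²} k₀²/(T−τ)`:
  the log-time quadratic mean of the efficiency of a DSS flow is its ONE-PERIOD AVERAGE `I₀/log(c²)` up to `O(1)`.
  So on the DSS stratum the crux (equivalently its sharp form, `nearExtremalTransience_iff_sharp_onsetZero`) reads: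
  «`sup` over DSS Type-I singular flows of the period average of `R²` is `< κ⋆²`» — per flow the average is
  trivially `≤ κ⋆²`, and `< κ⋆²` as soon as `R < κ⋆` on a positive-measure set of one period (e.g. if `κ⋆` is not
  attained on the admissible class); the uniformity over flows is the whole remaining content.

WHAT THIS IS NOT: no DSS blow-up is constructed or excluded; no `θ < 1`; the crux, its BC5 rung, the route and the
summit stay open; Navier–Stokes regularity is NOT proved. [folklore]
-/

noncomputable section

open Set Filter Topology MeasureTheory
open scoped InnerProductSpace RealInnerProductSpace ENNReal NNReal ContDiff
open Literature.Analysis.FluidPDE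

namespace Summit.NavierStokesRegularity.NavierStokesRegularity.Theorems

-- the problem directory repeats the summit name (`NavierStokesRegularity/NavierStokesRegularity`)
set_option linter.dupNamespace false

namespace DepletionLadder

/-! ## Calculus: blocks of arbitrary log-length -/

/-- **Per-block bounds sum to a log-time bound, blocks of log-length `ℓ > 0`.** If `g ≥ 0` on `[t₁,T)`
(`t₁ < T`) is interval-integrable on every `[t₁,t]`, `t < T`, and `∫_{s n}^{s (n+1)} g ≤ A` (`A ≥ 0`) on the blocks
`s n = T − (T−t₁)e^{−nℓ}`, then `∫_{t₁}^t g ≤ (A/ℓ)·log((T−t₁)/(T−t)) + A` for all `t ∈ [t₁,T)` (the first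
`⌈L/ℓ⌉ ≤ L/ℓ + 1` blocks cover `[t₁,t]`, `L = log((T−t₁)/(T−t))`). The case `ℓ = 1` is `Birth.stub_blocksToLog`.
[folklore] -/
theorem blocksToLog_general {g : ℝ → ℝ} {t₁ T A ℓ : ℝ} (ht₁T : t₁ < T) (hA : 0 ≤ A) (hℓ : 0 < ℓ)
    (hg0 : ∀ τ ∈ Ico t₁ T, 0 ≤ g τ) (hgi : ∀ t ∈ Ico t₁ T, IntervalIntegrable g volume t₁ t)
    (hblock : ∀ n : ℕ, ∫ τ in (T - (T - t₁) * Real.exp (-(n * ℓ)))..(T - (T - t₁) * Real.exp (-((n + 1) * ℓ))),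
      g τ ≤ A) :
    ∀ t ∈ Ico t₁ T, ∫ τ in t₁..t, g τ ≤ A / ℓ * Real.log ((T - t₁) / (T - t)) + A := by
  intro t ht
  obtain ⟨s, hs⟩ : ∃ s : ℕ → ℝ, ∀ n, s n = T - (T - t₁) * Real.exp (-(n * ℓ)) := ⟨_, fun _ => rfl⟩
  have hTt : 0 < T - t := sub_pos.2 ht.2
  have hTt₁ : 0 < T - t₁ := sub_pos.2 ht₁T
  have hs0 : s 0 = t₁ := by rw [hs]; simp
  have hsT : ∀ n, s n < T := fun n => by
    have h : 0 < (T - t₁) * Real.exp (-(n * ℓ)) := mul_pos hTt₁ (Real.exp_pos _)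
    rw [hs]; linarith
  have hs_mono : Monotone s := by
    intro m n hmn
    rw [hs, hs]
    have h : Real.exp (-(n * ℓ)) ≤ Real.exp (-(m * ℓ)) :=
      Real.exp_le_exp.2 (neg_le_neg (mul_le_mul_of_nonneg_right (Nat.cast_le.2 hmn) hℓ.le))
    nlinarith
  have ht₁s : ∀ n, t₁ ≤ s n := fun n => by rw [← hs0]; exact hs_mono (Nat.zero_le n)
  set L : ℝ := Real.log ((T - t₁) / (T - t)) with hL
  have hL0 : 0 ≤ L := Real.log_nonneg ((one_le_div hTt).2 (by linarith [ht.1]))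
  set N : ℕ := ⌈L / ℓ⌉₊ with hN
  have hNL : (N : ℝ) < L / ℓ + 1 := Nat.ceil_lt_add_one (div_nonneg hL0 hℓ.le)
  have hLN : L / ℓ ≤ N := Nat.le_ceil _
  have hLN' : L ≤ N * ℓ := by rwa [div_le_iff₀ hℓ] at hLN
  -- `t ≤ s N`
  have htsN : t ≤ s N := by
    have h1 : Real.exp (-(N * ℓ)) ≤ Real.exp (-L) := Real.exp_le_exp.2 (neg_le_neg hLN')
    have h2 : Real.exp (-L) = (T - t) / (T - t₁) := by
      rw [hL, Real.exp_neg, Real.exp_log (div_pos hTt₁ hTt), inv_div]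
    have h3 : (T - t₁) * Real.exp (-(N * ℓ)) ≤ T - t := by
      calc (T - t₁) * Real.exp (-(N * ℓ)) ≤ (T - t₁) * ((T - t) / (T - t₁)) := by
            rw [← h2]; exact mul_le_mul_of_nonneg_left h1 hTt₁.le
        _ = T - t := by field_simp
    rw [hs]; linarith
  have hblk_int : ∀ k < N, IntervalIntegrable g volume (s k) (s (k + 1)) := by
    intro k _
    refine (hgi (s (k + 1)) ⟨ht₁s _, hsT _⟩).mono_set ?_
    rw [uIcc_of_le (ht₁s _), uIcc_of_le (hs_mono (Nat.le_succ k))]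
    exact Icc_subset_Icc (ht₁s k) le_rfl
  have hsum : ∑ k ∈ Finset.range N, ∫ τ in s k..s (k + 1), g τ = ∫ τ in s 0..s N, g τ :=
    intervalIntegral.sum_integral_adjacent_intervals hblk_int
  have hmono : ∫ τ in t₁..t, g τ ≤ ∫ τ in t₁..s N, g τ := by
    refine intervalIntegral.integral_mono_interval le_rfl ht.1 htsN ?_ (hgi (s N) ⟨ht₁s _, hsT _⟩)
    refine (ae_restrict_mem measurableSet_Ioc).mono fun τ hτ => ?_
    exact hg0 τ ⟨hτ.1.le, lt_of_le_of_lt hτ.2 (hsT N)⟩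
  have hblocks : ∑ k ∈ Finset.range N, ∫ τ in s k..s (k + 1), g τ ≤ ∑ _k ∈ Finset.range N, A := by
    refine Finset.sum_le_sum fun k _ => ?_
    have h := hblock k
    rw [hs, hs]
    push_cast
    exact h
  calc ∫ τ in t₁..t, g τ ≤ ∫ τ in t₁..s N, g τ := hmono
    _ = ∑ k ∈ Finset.range N, ∫ τ in s k..s (k + 1), g τ := by rw [hsum, hs0]
    _ ≤ ∑ _k ∈ Finset.range N, A := hblocks
    _ = (N : ℝ) * A := by simp
    _ ≤ (L / ℓ + 1) * A := mul_le_mul_of_nonneg_right hNL.le hA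
    _ = A / ℓ * L + A := by ring

/-! ## DSS flows: all blocks of log-length `log(c²)` carry the same mass -/

/-- **Shift of one block along a DSS flow.** For a flow discretely self-similar about `T` with factor `c > 1` and a
minimal flow-wise coefficient `k₀ ≥ 0` (clause and minimality on `[0,T)`), and `0 ≤ a ≤ b < T`:
`∫_{φ a}^{φ b} k₀²/(T−τ) dτ = ∫_a^b k₀²/(T−τ) dτ` with `φ τ = T − (T−τ)/c²` (substitution; `k₀ ∘ φ = k₀` on `[0,T)` by
`minimalCoeff_logPeriodic_of_dss`, and `(T − φ τ) = (T−τ)/c²`). [folklore] -/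
theorem dss_integral_shift {c T : ℝ} (hc : 1 < c) (hT : 0 < T)
    {u : ℝ → EuclideanSpace ℝ (Fin 3) → EuclideanSpace ℝ (Fin 3)}
    (hdss : IsDiscretelySelfSimilar c (fun s x => u (T + s) x))
    {k₀ : ℝ → ℝ} (hk₀0 : ∀ τ, 0 ≤ k₀ τ)
    (hcl : ∀ t ∈ Ico 0 T, ∀ M : ℝ, (∀ x, ‖u t x‖ ≤ M) →
      |∫ x, ⟪curl (u t) x, fderiv ℝ (u t) x (curl (u t) x)⟫_ℝ| ≤
        k₀ t * M * Real.sqrt (∫ x, ‖curl (u t) x‖ ^ 2) *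
          Real.sqrt (∫ x, frobeniusNormSq (fderiv ℝ (curl (u t)) x)))
    (hmin : ∀ t ∈ Ico 0 T, ∀ c : ℝ, 0 ≤ c →
      (∀ M : ℝ, (∀ x, ‖u t x‖ ≤ M) →
        |∫ x, ⟪curl (u t) x, fderiv ℝ (u t) x (curl (u t) x)⟫_ℝ| ≤
          c * M * Real.sqrt (∫ x, ‖curl (u t) x‖ ^ 2) *
            Real.sqrt (∫ x, frobeniusNormSq (fderiv ℝ (curl (u t)) x))) → k₀ t ≤ c)
    {a b : ℝ} (ha : 0 ≤ a) (hab : a ≤ b) (hb : b < T) :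
    ∫ τ in (T - (T - a) / c ^ 2)..(T - (T - b) / c ^ 2), k₀ τ ^ 2 / (T - τ) =
      ∫ τ in a..b, k₀ τ ^ 2 / (T - τ) := by
  have hc0 : 0 < c := lt_trans one_pos hc
  have hc2 : 0 < c ^ 2 := pow_pos hc0 2
  have hc2' : (c ^ 2)⁻¹ ≠ 0 := inv_ne_zero hc2.ne'
  have hc1 : 1 ≤ c ^ 2 := by nlinarith
  -- the substitution `τ = (c²)⁻¹·x + T(1 − (c²)⁻¹)`
  have hsub := intervalIntegral.integral_comp_mul_add (fun τ => k₀ τ ^ 2 / (T - τ)) hc2'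
    (T * (1 - (c ^ 2)⁻¹)) (a := a) (b := b)
  have hφa : (c ^ 2)⁻¹ * a + T * (1 - (c ^ 2)⁻¹) = T - (T - a) / c ^ 2 := by field_simp; ring
  have hφb : (c ^ 2)⁻¹ * b + T * (1 - (c ^ 2)⁻¹) = T - (T - b) / c ^ 2 := by field_simp; ring
  rw [hφa, hφb, inv_inv] at hsub
  -- pointwise: the transported integrand is `c²` times the integrand
  have hpt : ∀ x ∈ uIcc a b, (fun τ => k₀ τ ^ 2 / (T - τ)) ((c ^ 2)⁻¹ * x + T * (1 - (c ^ 2)⁻¹)) =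
      c ^ 2 * (k₀ x ^ 2 / (T - x)) := by
    intro x hx
    rw [uIcc_of_le hab] at hx
    have hx0 : 0 ≤ x := ha.trans hx.1
    have hxT : x < T := lt_of_le_of_lt hx.2 hb
    set σ : ℝ := (T - x) / c ^ 2 with hσ
    have hσ0 : 0 < σ := div_pos (sub_pos.2 hxT) hc2
    have hσc : c ^ 2 * σ = T - x := by rw [hσ]; field_simp
    have hσT : σ ≤ T := by
      rw [hσ, div_le_iff₀ hc2]; nlinarith
    have hσcT : c ^ 2 * σ ≤ T := by rw [hσc]; linarith
    have hφ : (c ^ 2)⁻¹ * x + T * (1 - (c ^ 2)⁻¹) = T - σ := by rw [hσ]; field_simp; ring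
    have hper := minimalCoeff_logPeriodic_of_dss hc0 hdss hk₀0 hcl hmin hσ0 hσT hσcT
    rw [hσc, show T - (T - x) = x by ring] at hper
    show k₀ ((c ^ 2)⁻¹ * x + T * (1 - (c ^ 2)⁻¹)) ^ 2 / (T - ((c ^ 2)⁻¹ * x + T * (1 - (c ^ 2)⁻¹))) =
      c ^ 2 * (k₀ x ^ 2 / (T - x))
    rw [hφ, hper, show T - (T - σ) = σ by ring, hσ]
    field_simp
  rw [intervalIntegral.integral_congr hpt, intervalIntegral.integral_const_mul, smul_eq_mul] at hsub
  -- `c² ∫_a^b = c² ∫_{φ a}^{φ b}`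
  have := mul_left_cancel₀ hc2.ne' hsub
  exact this.symm

/-- **The period mass.** Along a DSS flow (factor `c > 1`) with minimal coefficient `k₀ ≥ 0`, all blocks
`[T − (T−t₁)e^{−nℓ}, T − (T−t₁)e^{−(n+1)ℓ}]`, `ℓ = log(c²)`, `0 ≤ t₁ < T`, carry the same mass of `k₀²/(T−τ)`:
it equals `I₀ = ∫_{t₁}^{T−(T−t₁)/c²} k₀²/(T−τ)` for every `n` (induction on `n` with `dss_integral_shift`). [folklore] -/
theorem dss_block_integral_eq {c T t₁ : ℝ} (hc : 1 < c) (hT : 0 < T) (ht₁ : t₁ ∈ Ico 0 T)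
    {u : ℝ → EuclideanSpace ℝ (Fin 3) → EuclideanSpace ℝ (Fin 3)}
    (hdss : IsDiscretelySelfSimilar c (fun s x => u (T + s) x))
    {k₀ : ℝ → ℝ} (hk₀0 : ∀ τ, 0 ≤ k₀ τ)
    (hcl : ∀ t ∈ Ico 0 T, ∀ M : ℝ, (∀ x, ‖u t x‖ ≤ M) →
      |∫ x, ⟪curl (u t) x, fderiv ℝ (u t) x (curl (u t) x)⟫_ℝ| ≤
        k₀ t * M * Real.sqrt (∫ x, ‖curl (u t) x‖ ^ 2) *
          Real.sqrt (∫ x, frobeniusNormSq (fderiv ℝ (curl (u t)) x)))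
    (hmin : ∀ t ∈ Ico 0 T, ∀ c : ℝ, 0 ≤ c →
      (∀ M : ℝ, (∀ x, ‖u t x‖ ≤ M) →
        |∫ x, ⟪curl (u t) x, fderiv ℝ (u t) x (curl (u t) x)⟫_ℝ| ≤
          c * M * Real.sqrt (∫ x, ‖curl (u t) x‖ ^ 2) *
            Real.sqrt (∫ x, frobeniusNormSq (fderiv ℝ (curl (u t)) x))) → k₀ t ≤ c)
    (n : ℕ) :
    ∫ τ in (T - (T - t₁) * Real.exp (-(n * Real.log (c ^ 2))))..(T - (T - t₁) *
        Real.exp (-((n + 1) * Real.log (c ^ 2)))), k₀ τ ^ 2 / (T - τ) =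
      ∫ τ in t₁..(T - (T - t₁) / c ^ 2), k₀ τ ^ 2 / (T - τ) := by
  have hc0 : 0 < c := lt_trans one_pos hc
  have hc2 : 0 < c ^ 2 := pow_pos hc0 2
  have hTt₁ : 0 < T - t₁ := sub_pos.2 ht₁.2
  -- `e^{−m log(c²)} = (c²)^{−m}`; the block endpoints
  have hexp : ∀ m : ℕ, Real.exp (-(m * Real.log (c ^ 2))) = ((c ^ 2) ^ m)⁻¹ := by
    intro m
    rw [Real.exp_neg, ← Real.log_pow, Real.exp_log (pow_pos hc2 m)]
  induction n with
  | zero =>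
    congr 1
    · simp
    · rw [show ((0 : ℕ) : ℝ) + 1 = ((1 : ℕ) : ℝ) by norm_num, hexp 1, pow_one, div_eq_mul_inv]
  | succ m ih =>
    -- block `m+1` is the image of block `m` under `τ ↦ T − (T−τ)/c²`
    have hlo : 0 ≤ T - (T - t₁) * Real.exp (-(m * Real.log (c ^ 2))) := by
      rw [hexp]
      have h1 : (T - t₁) * ((c ^ 2) ^ m)⁻¹ ≤ (T - t₁) * 1 :=
        mul_le_mul_of_nonneg_left (inv_le_one_of_one_le₀ (one_le_pow₀ (by nlinarith))) hTt₁.le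
      linarith [ht₁.1]
    have hle : T - (T - t₁) * Real.exp (-(m * Real.log (c ^ 2))) ≤
        T - (T - t₁) * Real.exp (-((m + 1) * Real.log (c ^ 2))) := by
      have h : Real.exp (-((m + 1) * Real.log (c ^ 2))) ≤ Real.exp (-(m * Real.log (c ^ 2))) :=
        Real.exp_le_exp.2 (neg_le_neg (mul_le_mul_of_nonneg_right (by linarith)
          (Real.log_nonneg (by nlinarith))))
      nlinarith [Real.exp_pos (-((m + 1) * Real.log (c ^ 2)))]
    have hhi : T - (T - t₁) * Real.exp (-((m + 1) * Real.log (c ^ 2))) < T := by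
      have : 0 < (T - t₁) * Real.exp (-((m + 1) * Real.log (c ^ 2))) := mul_pos hTt₁ (Real.exp_pos _)
      linarith
    have hshift := dss_integral_shift hc hT hdss hk₀0 hcl hmin hlo hle hhi
    -- endpoints: `T − (T − s m)/c² = s (m+1)`, `T − (T − s (m+1))/c² = s (m+2)`
    have hstep : ∀ r : ℝ, Real.exp (-((r + 1) * Real.log (c ^ 2))) =
        Real.exp (-(r * Real.log (c ^ 2))) / c ^ 2 := by
      intro r
      rw [show -((r + 1) * Real.log (c ^ 2)) = -(r * Real.log (c ^ 2)) + -Real.log (c ^ 2) by ring,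
        Real.exp_add, Real.exp_neg (Real.log (c ^ 2)), Real.exp_log hc2, div_eq_mul_inv]
    have e1 : T - (T - (T - (T - t₁) * Real.exp (-(m * Real.log (c ^ 2))))) / c ^ 2 =
        T - (T - t₁) * Real.exp (-(((m + 1 : ℕ) : ℝ) * Real.log (c ^ 2))) := by
      rw [show ((m + 1 : ℕ) : ℝ) = (m : ℝ) + 1 by push_cast; ring, hstep]
      ring
    have e2 : T - (T - (T - (T - t₁) * Real.exp (-((m + 1) * Real.log (c ^ 2))))) / c ^ 2 =
        T - (T - t₁) * Real.exp (-((((m + 1 : ℕ) : ℝ) + 1) * Real.log (c ^ 2))) := by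
      rw [show ((m + 1 : ℕ) : ℝ) = (m : ℝ) + 1 by push_cast; ring, hstep ((m : ℝ) + 1)]
      ring
    rw [e1, e2] at hshift
    rw [hshift]
    exact ih

/-- **ON THE DSS STRATUM THE LOG-TIME MEAN IS THE PERIOD AVERAGE.** Let `u` be discretely self-similar about `T`
with factor `c > 1` (`IsDiscretelySelfSimilar c (fun s x => u (T + s) x)`), and let `k₀ : ℝ → [0,1]` be a
measurable minimal flow-wise depletion coefficient on `[0,T)` (the stretching efficiency; for classical
Leray–Hopf rapidly-decaying-datum flows it exists, `exists_canonical_coefficient`). Then for every onset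
`t₁ ∈ [0,T)` and every `t ∈ [t₁,T)`:
`∫_{t₁}^t k₀²/(T−τ) ≤ (I₀/log(c²))·log((T−t₁)/(T−t)) + I₀`, with the period mass
`I₀ = ∫_{t₁}^{T−(T−t₁)/c²} k₀²/(T−τ)`. So the crux's BC5 rung holds for THIS flow at every level `(θκ)² ≥ I₀/log(c²)`
(the period average of `R²`); what the rung asserts beyond this is the UNIFORM bound `sup_u I₀(u)/log(c_u²) < κ⋆²`.
[folklore] -/
theorem logMean_le_periodAverage_of_dss {c T t₁ : ℝ} (hc : 1 < c) (hT : 0 < T) (ht₁ : t₁ ∈ Ico 0 T)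
    {u : ℝ → EuclideanSpace ℝ (Fin 3) → EuclideanSpace ℝ (Fin 3)}
    (hdss : IsDiscretelySelfSimilar c (fun s x => u (T + s) x))
    {k₀ : ℝ → ℝ} (hk₀m : Measurable k₀) (hk₀01 : ∀ τ, 0 ≤ k₀ τ ∧ k₀ τ ≤ 1)
    (hcl : ∀ t ∈ Ico 0 T, ∀ M : ℝ, (∀ x, ‖u t x‖ ≤ M) →
      |∫ x, ⟪curl (u t) x, fderiv ℝ (u t) x (curl (u t) x)⟫_ℝ| ≤
        k₀ t * M * Real.sqrt (∫ x, ‖curl (u t) x‖ ^ 2) *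
          Real.sqrt (∫ x, frobeniusNormSq (fderiv ℝ (curl (u t)) x)))
    (hmin : ∀ t ∈ Ico 0 T, ∀ c : ℝ, 0 ≤ c →
      (∀ M : ℝ, (∀ x, ‖u t x‖ ≤ M) →
        |∫ x, ⟪curl (u t) x, fderiv ℝ (u t) x (curl (u t) x)⟫_ℝ| ≤
          c * M * Real.sqrt (∫ x, ‖curl (u t) x‖ ^ 2) *
            Real.sqrt (∫ x, frobeniusNormSq (fderiv ℝ (curl (u t)) x))) → k₀ t ≤ c) :
    ∀ t ∈ Ico t₁ T, ∫ τ in t₁..t, k₀ τ ^ 2 / (T - τ) ≤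
      (∫ τ in t₁..(T - (T - t₁) / c ^ 2), k₀ τ ^ 2 / (T - τ)) / Real.log (c ^ 2) *
        Real.log ((T - t₁) / (T - t)) + ∫ τ in t₁..(T - (T - t₁) / c ^ 2), k₀ τ ^ 2 / (T - τ) := by
  have hc0 : 0 < c := lt_trans one_pos hc
  have hc2 : 1 < c ^ 2 := by nlinarith
  have hℓ : 0 < Real.log (c ^ 2) := Real.log_pos hc2
  have hTt₁ : 0 < T - t₁ := sub_pos.2 ht₁.2
  set I₀ : ℝ := ∫ τ in t₁..(T - (T - t₁) / c ^ 2), k₀ τ ^ 2 / (T - τ) with hI₀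
  -- `I₀ ≥ 0`
  have hs1 : t₁ ≤ T - (T - t₁) / c ^ 2 := by
    have h : (T - t₁) / c ^ 2 ≤ T - t₁ := div_le_self hTt₁.le hc2.le
    linarith
  have hs1T : T - (T - t₁) / c ^ 2 < T := by
    have : 0 < (T - t₁) / c ^ 2 := div_pos hTt₁ (by positivity)
    linarith
  have hI₀0 : 0 ≤ I₀ :=
    intervalIntegral.integral_nonneg hs1 fun τ hτ => div_nonneg (sq_nonneg _) (by linarith [hτ.2])
  have hg0 : ∀ τ ∈ Ico t₁ T, 0 ≤ k₀ τ ^ 2 / (T - τ) := fun τ hτ =>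
    div_nonneg (sq_nonneg _) (sub_nonneg.2 hτ.2.le)
  have hgi : ∀ t ∈ Ico t₁ T, IntervalIntegrable (fun τ => k₀ τ ^ 2 / (T - τ)) volume t₁ t :=
    fun t ht => intervalIntegrable_coeff_sq_div hk₀m hk₀01 ht.1 ht.2
  have hblock : ∀ n : ℕ, ∫ τ in (T - (T - t₁) * Real.exp (-(n * Real.log (c ^ 2))))..(T - (T - t₁) *
      Real.exp (-((n + 1) * Real.log (c ^ 2)))), k₀ τ ^ 2 / (T - τ) ≤ I₀ :=
    fun n => (dss_block_integral_eq hc hT ht₁ hdss (fun τ => (hk₀01 τ).1) hcl hmin n).le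
  exact blocksToLog_general ht₁.2 hI₀0 hℓ hg0 hgi hblock

end DepletionLadder

end Summit.NavierStokesRegularity.NavierStokesRegularity.Theorems

end
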